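import Mathlib
import HarnessLib
import Literature.Analysis.FluidPDE.SelfSimilar
import Summits.NavierStokesRegularity.NavierStokesRegularity.Theses.AngularGalerkinLadder
import Summits.NavierStokesRegularity.NavierStokesRegularity.Theorems.RungBlowupCofinal.LerayLineRungProfile

/-! # Skeleton line `leray` — THE STEADY (BACKWARD SELF-SIMILAR) LERAY LINE for crux `RungBlowupCofinal`
(item stmt-NavierStokesRegularity-19959, route `route-NavierStokesRegularity-AngularGalerkinLadder` №8, card K1;
crux-strategist cstrat-19959 g0, 2026-08-27; lens: strengthen + profile-and-certify)

THE CRUX (fixed): `∀ L₀, ∃ L ≥ L₀, RungIsSingular L` — cofinally many rungs `NS_L` of the angular Galerkin ladder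
carry a non-trivial Type-I rotated-DSS ANCIENT rung solution on `(−∞, 0) × ℝ³`.

THE LEVER (absent from both registered lines `Lines/birth.lean` v4 and `Lines/halfturn.lean` v4, which go through a
FORWARD Cauchy blow-up + tangent-flow extraction): the simplest inhabitant of `RungIsSingular L` is Leray's 1934
backward self-similar ansatz `u(t,x) = (−t)^{−1/2} U(x/√(−t))` built on a STEADY profile `U` of the TRUNCATED profile
equation. Because the projector `Π_L` commutes with dilations, `NS_L` is scaling-covariant about its centre, and a
smooth band-limited divergence-free `U : ℝ³ → ℝ³` with
  `−ΔU + ½U + ½(y·∇)U + (U·∇)U + ∇Q = E`,  `E` co-band-limited (the Galerkin defect),  `‖U(y)‖ ≤ C/(‖y‖+1)`, `U ≢ 0`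
(`IsSteadyLerayRungProfile L C U Q E` below) lifts to an exactly self-similar (`IsSelfSimilar`, hence
`IsRotatedDSS 2 refl`) ancient rung-`L` solution with `HasTypeIDecay C` — i.e. to a witness of `RungIsSingular L`.
So the crux is implied by the STRONGER, STATIONARY statement
  `C⁺ : ∀ L₀, ∃ L ≥ L₀, RungHasLerayProfile L`.
WHY `C⁺` IS EASIER (not a costume): it is an ELLIPTIC problem — per symmetry cell a boundary-value problem for finitely
many radial unknowns (HOME/profile/z2oct/OCT-REDUCED-SYSTEM.md §2: the O-cell rung-4 similarity system (T∞),(P∞) IS this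
equation with `a = ½, ν = 1`; its far field `Q ~ ρ⁻⁴, V ~ ρ⁻⁵` gives `|U| ~ ρ⁻¹`, so Type-I is automatic) — to which
(i) computer-assisted existence proofs (radii polynomials / Newton–Kantorovich, the Chen–Hou door WITHOUT the
time-dependent stability half), (ii) continuation / degree theory in `L`, and (iii) large-`L` asymptotic ansätze apply,
none of which is available for the parabolic forward problem of the other two lines. Every printed Liouville theorem
for backward self-similar NS profiles (Nečas–Růžička–Šverák 1996, Tsai 1998, Chae–Wolf, KNSS 2009; tree
`Literature.Analysis.FluidPDE.LerayProfileTriviality`, `TsaiDSSLiouville`, `Literature/Barriers/NavierStokesRegularity/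
LeraySelfSimilarBlowupExclusion`) runs through the local/strong maximum principle for the head pressure
`|U|²/2 + P + a y·U` or through `L³`/energy integrability; `Π_L` destroys the former (the defect `E` enters the head
pressure equation with no sign) and the Type-I tail `C/|y|` is outside the latter (refuter g14 KJ-17: 0/14 printed
criteria bite `NS_L`). MODEL evidence that `C⁺` is inhabited at the first nonlinear symmetric rung: OCT-P93
(HOME/profile/z2oct/CENSUS-Z2-OCT.md §§9–11; four independent codes, grid-converged root of the O_h-poloidal rung-4
reduced system: `A = 22.33`, shell radius `ρ_A = 13.69`, far constant `ρ⁴Q → −53.4`; the root PERSISTS, deformed, in the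
ℓ_max = 6 and 8 truncations: `A = 21.22 / 19.80`, `ρ_A = 19.4 / 26.3`) — a numerical root, not a theorem; it decides
nothing here and is cited only as the reason the BC5-type rung below is set at `L = 4`.

DECOMPOSITION OF EXISTENCE (why the stubs are what they are). The LIFT is a kernel theorem — circuit g10's
`Theorems/RungBlowupCofinal/LerayLineRungProfile.lean` (p517517 ACCEPTED 09:19Z:
`AngularGalerkinLadderLerayLine.rungIsSingular_of_lerayProfile`) — and is CITED below (`rungIsSingular_of_rungHasLerayProfile`,
real proof), so `C⁺ → crux` is the hypothesis-free theorem `RungBlowupCofinal_of_lerayProfiles_cofinal` of this file, and a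
line consisting of «profiles exist cofinally» alone would be a one-stub costume of `C⁺`. The content of this line is
therefore the NEWTON–KANTOROVICH SPLIT of `C⁺` — the exact shape in which a computer-assisted or asymptotic construction
delivers a profile:
* `stub_nk_door` (L-sized, analytic, TRUE-by-design): in the Type-I weighted classes at fixed `L`, an APPROXIMATE
  profile `U₀` (residual `≤ η` in the `(1+|y|)^{5/2}`-weighted sup norm) whose linearisation obeys an a-priori
  (injectivity) estimate with constant `K` MODULO THE GAUGE `(∇q, co-band-limited G)` has an EXACT profile within
  `C/4` of it, provided `η ≤ η(L, K, C)`. Print road: the linearised operator is `−Δ + ½ + ½y·∇` (explicitly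
  invertible on decaying classes, Hermite/Mehler kernel) plus a compact perturbation after `Π_L ∘ P` (angular projector
  and Leray projector, Calderón–Zygmund-bounded on power weights of order in `(0,3)`), so «injective with bound `K`» ⇒
  «invertible with bound `≲ K`» (Fredholm index 0) and the quadratic remainder `(W·∇)W` closes a contraction.
* `stub_nondegenerate_approx_profiles_cofinal` (XL, THE BET): cofinally in `L` there are arbitrarily accurate,
  uniformly non-degenerate (fixed `K`), uniformly Type-I (fixed `C`), non-collapsing (`sup (1+|y|)|U₀| ≥ C/2`)
  approximate profiles. At a single rung this is exactly what a verified Newton/radii-polynomial computation outputs;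
  cofinality needs a mechanism in `L` (θ-continuation rung `L → L+2` with a priori bounds = a cell-Liouville theorem for
  the steady Galerkin system, or a large-`L` sectoral ansatz) — open, and where this line can die.
* (no lift stub: the lift is p517517, cited.)
* `stub_leray_rung_four` (plan-only BC5-type rung, MODEL evidence OCT-P93): `RungHasLerayProfile 4`; consumed by the
  real composition `rungBlowupCofinal_instances_le_four` (instances `L₀ ≤ 4` of the crux).
Composition `RungBlowupCofinal_of` (door → approximate profiles cofinally → crux) is a real proof concluding the crux BY
NAME (`Goal`); sorries ONLY inside the three `stub_*`.

DECLARED INCAPABILITY (carried verbatim from circuit g10 (A), kernel p515522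
`Theorems/NoOverheating/Negative/SelfSimilarWindowsExcluded.lean`: `not_tendsto_defectSize_of_selfSimilar_rungProfiles`,
`not_cofinal_and_noOverheating_selfSimilar`, `rungBlowupCofinal_false_of_noOverheating_selfSimilar`): exactly
self-similar rung profiles with one Type-I constant and an amplitude floor can NEVER have defect size `ε_L → 0` — the
Leray line is «K1-capable, K2-incapable». This line claims K1 only. Its bearing on the ROUTE is a typing remark for the
tenure planner (card §Route note): K2 `NoOverheating` quantifies over EVERY singular rung `L ≥ L₀`; the more rungs K1
makes singular through self-similar profiles, the more K2 must be witnessed by OTHER (non-self-similar, `C₀ > ε₀`,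
non-axisymmetric) window profiles on those same rungs.

DISPROOF / NEGATIVE RECORD HONOURED. No `Disproof.lean` exists for this crux. KJ-18 (p475616 `ForwardStubParasitic`),
KJ-20 (p479287 `LinearStrainParasitic`), KJ-21 (p480997 `KnssGuard`, p482353 `KnssTangentDecay`) kill FORWARD letters
inhabited by the KNSS drift / linear strain flows: this line has no forward letter — its only existential object is a
spatial profile with `‖U(y)‖ ≤ C/(‖y‖+1)` (drifts and strain flows do not decay) and a non-collapse floor (`U₀ ≡ 0`
excluded); the gauge junk of K2-v3 (`u ≡ 0, p = x₀, d = e₀` at `L = 0`) is excluded by the same floor.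
`RungZeroNotSingular` (p484389): the BC5-type rung is `L = 4 > 0`. `SignCellGalerkinNonlinearity` (p503248): the
tetrahedral rung-3 cell is LINEAR (no profile) — the first cell this line aims at is the octahedral rung-4 cell.
Centre-germ negatives (`OddCellCentreJet`, `StrainSector*`, `HalfTurnGermTriaxialIff`, `AxisymmetricGermNotTriaxial`)
concern Taylor jets at the centre of forward data; a steady O-cell profile has `∇U(0) = 0` and lives on a shell
(`ρ_A ≈ 13.7`), so they do not bear on it — but an AXISYMMETRIC profile, though a K1 witness, is chain-dead for K3
(p466949), so provers aim at cells fixing no line (O, and its ℓ-refinements).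
WHAT THIS IS NOT: not NS — a registered plan about the truncations `NS_L`; nothing is proved about Navier–Stokes. -/

set_option linter.dupNamespace false

namespace Summit.NavierStokesRegularity.NavierStokesRegularity.Cruxes.RungBlowupCofinal.Leray

/-- The crux behind a local abbreviation (audit shape): `RungBlowupCofinal_of` concludes `Goal`. -/
abbrev Goal : Prop := Summit.NavierStokesRegularity.NavierStokesRegularity.Theses.AngularGalerkinLadder.RungBlowupCofinal

open scoped Topology Laplacian ContDiff RealInnerProductSpace
open Filter Set MeasureTheory InnerProductSpace
open Summit.NavierStokesRegularity.FluidComputer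
open Literature.Analysis.FluidPDE

local notation "ℝ³" => EuclideanSpace ℝ (Fin 3)

/-! ## The stationary objects -/

/-- **Residual of the truncated backward Leray profile system** (`ν = 1`, `a = ½`, tree `IsLerayProfile` with a force):
`lerayResidual U Q E y = −ΔU(y) + ½U(y) + ½DU(y)·y + (U·∇)U(y) + ∇Q(y) − E(y)`. -/
noncomputable def lerayResidual (U : ℝ³ → ℝ³) (Q : ℝ³ → ℝ) (E : ℝ³ → ℝ³) (y : ℝ³) : ℝ³ :=
  -(Δ U) y + (1 / 2 : ℝ) • U y + (1 / 2 : ℝ) • fderiv ℝ U y y + convect U U y + gradient Q y - E y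

/-- **STEADY LERAY RUNG PROFILE at level `L` with Type-I constant `C`**: a smooth band-limited (degree `≤ L`)
divergence-free profile `U`, a smooth pressure `Q` and a smooth CO-band-limited defect `E` (the Galerkin remainder
`(1 − Π_L)` of the nonlinearity, entering as a force) solving the backward profile system exactly, with the scale-free
tail bound `‖U(y)‖ ≤ C/(‖y‖ + 1)` (the `t = −1` slice of `HasTypeIDecay C`). -/
def IsSteadyLerayRungProfile (L : ℕ) (C : ℝ) (U : ℝ³ → ℝ³) (Q : ℝ³ → ℝ) (E : ℝ³ → ℝ³) : Prop :=
  AngularLadder.IsBandLimited L U ∧ VectorCalculus.IsDivFree U ∧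
    ContDiff ℝ ∞ Q ∧ ContDiff ℝ ∞ E ∧ AngularLadder.IsCobandLimited L E ∧
    (∀ y, lerayResidual U Q E y = 0) ∧
    ∀ y, ‖U y‖ ≤ C / (‖y‖ + 1)

/-- **Rung `L` carries a non-trivial steady Leray profile** (the stationary strengthening `C⁺_L` of `RungIsSingular L`). -/
def RungHasLerayProfile (L : ℕ) : Prop :=
  ∃ (C : ℝ) (U : ℝ³ → ℝ³) (Q : ℝ³ → ℝ) (E : ℝ³ → ℝ³), IsSteadyLerayRungProfile L C U Q E ∧ ∃ y, U y ≠ 0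

/-! ## The Newton–Kantorovich letter -/

/-- **Residual of the LINEARISED profile system at `U₀`** applied to a variation `W` with pressure variation `q` and
defect variation `G`: `−ΔW + ½W + ½DW·y + (U₀·∇)W + (W·∇)U₀ + ∇q − G`. -/
noncomputable def lerayLinResidual (U₀ W : ℝ³ → ℝ³) (q : ℝ³ → ℝ) (G : ℝ³ → ℝ³) (y : ℝ³) : ℝ³ :=
  -(Δ W) y + (1 / 2 : ℝ) • W y + (1 / 2 : ℝ) • fderiv ℝ W y y + convect U₀ W y + convect W U₀ y +
    gradient q y - G y

/-- **The Type-I test class at level `L`**: smooth band-limited divergence-free fields with the scale-critical weighted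
bounds `(1+‖y‖)‖W(y)‖ ≤ B`, `(1+‖y‖)²‖DW(y)‖ ≤ B` for some `B` (the tangent space in which Newton's method runs). -/
def IsTypeITestField (L : ℕ) (W : ℝ³ → ℝ³) : Prop :=
  AngularLadder.IsBandLimited L W ∧ VectorCalculus.IsDivFree W ∧
    ∃ B : ℝ, ∀ y, (1 + ‖y‖) * ‖W y‖ ≤ B ∧ (1 + ‖y‖) ^ 2 * ‖fderiv ℝ W y‖ ≤ B

/-- **Linear stability (non-degeneracy) of `U₀` at level `L` with constant `K`** — an a-priori INJECTIVITY estimate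
for the linearisation MODULO THE GAUGE: for every Type-I test field `W`, every smooth `q` and every smooth
co-band-limited `G`, a `(1+‖y‖)^{5/2}`-weighted sup bound `B` on the linearised residual controls the Type-I norms of
`W` by `K·B` (stated bound-by-bound: no suprema, no function spaces). At an exact or approximate profile this is the
invertibility of the Fréchet derivative that a radii-polynomial / Newton–Kantorovich certificate verifies. -/
def IsLinearlyStable (L : ℕ) (K : ℝ) (U₀ : ℝ³ → ℝ³) : Prop :=
  ∀ (W : ℝ³ → ℝ³) (q : ℝ³ → ℝ) (G : ℝ³ → ℝ³) (B : ℝ),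
    IsTypeITestField L W → ContDiff ℝ ∞ q → ContDiff ℝ ∞ G → AngularLadder.IsCobandLimited L G →
    (∀ y, (1 + ‖y‖) ^ (5 / 2 : ℝ) * ‖lerayLinResidual U₀ W q G y‖ ≤ B) →
    ∀ y, (1 + ‖y‖) * ‖W y‖ + (1 + ‖y‖) ^ 2 * ‖fderiv ℝ W y‖ ≤ K * B

/-- **APPROXIMATE steady Leray rung profile** at level `L` with stability constant `K`, Type-I constant `C` and
accuracy `η`: a Type-I test field `U₀` with `‖U₀(y)‖ ≤ C/(‖y‖+1)`, a smooth pressure guess `Q₀` and a smooth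
co-band-limited defect guess `E₀` whose profile residual is `≤ η (1+‖y‖)^{−5/2}` pointwise, `U₀` being linearly stable
with constant `K`. (What a verified numerical profile IS, as a proposition.) -/
def IsApproxLerayRungProfile (L : ℕ) (K C η : ℝ) (U₀ : ℝ³ → ℝ³) (Q₀ : ℝ³ → ℝ) (E₀ : ℝ³ → ℝ³) : Prop :=
  IsTypeITestField L U₀ ∧ (∀ y, ‖U₀ y‖ ≤ C / (‖y‖ + 1)) ∧
    ContDiff ℝ ∞ Q₀ ∧ ContDiff ℝ ∞ E₀ ∧ AngularLadder.IsCobandLimited L E₀ ∧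
    (∀ y, (1 + ‖y‖) ^ (5 / 2 : ℝ) * ‖lerayResidual U₀ Q₀ E₀ y‖ ≤ η) ∧
    IsLinearlyStable L K U₀

/-! ## Stubs (sorries live ONLY here) -/

/-- stub 1 (L, analytic, true-by-design): **the Newton–Kantorovich door in Type-I classes at fixed `L`.** Given the
level `L`, a stability constant `K` and a Type-I constant `C`, there is an accuracy `η > 0` such that every
`(K, C, η)`-approximate profile has an EXACT steady Leray rung profile within `C/4` of it in the weighted sup norm
(with some Type-I constant `C'`, pressure `Q`, co-band-limited defect `E`). Print road: `A = −Δ + ½ + ½y·∇` is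
invertible on `(1+|y|)^{−σ}`-weighted Hölder classes for `σ ∈ (1,3)` with two derivatives gained (Mehler kernel of the
backward Ornstein–Uhlenbeck–Stokes semigroup); `Π_L` (angular projector) and the Leray projector are bounded there
(Calderón–Zygmund with power weights of order `< 3`); `W ↦ A⁻¹ Π_L P((U₀·∇)W + (W·∇)U₀)` is compact, so the
injectivity estimate `IsLinearlyStable` upgrades to invertibility (Fredholm index `0`) and `(W·∇)W` (weight `3 ≥ 5/2`)
closes the contraction; `E := (1 − Π_L) P`-part, `Q` from the Leray projection. Why it might fail: only by a typing
slip in the weighted classes (e.g. the log-loss at the critical source weight `3`, avoided by `5/2`). -/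
theorem stub_nk_door :
    ∀ (L : ℕ) (K C : ℝ), ∃ η > 0, ∀ (U₀ : ℝ³ → ℝ³) (Q₀ : ℝ³ → ℝ) (E₀ : ℝ³ → ℝ³),
      IsApproxLerayRungProfile L K C η U₀ Q₀ E₀ →
        ∃ (C' : ℝ) (U : ℝ³ → ℝ³) (Q : ℝ³ → ℝ) (E : ℝ³ → ℝ³),
          IsSteadyLerayRungProfile L C' U Q E ∧ ∀ y, (1 + ‖y‖) * ‖U y - U₀ y‖ ≤ C / 4 := by
  sorry

/-- stub 2 (XL, THE BET of the line): **uniformly non-degenerate, non-collapsing approximate profiles cofinally in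
`L`.** For cofinally many rungs there are constants `K, C > 0` and, for every accuracy `η > 0`, a `(K, C, η)`-approximate
steady Leray rung profile whose weighted amplitude reaches `C/2` somewhere. At ONE rung this is the output of a verified
Newton / radii-polynomial computation on the cell-reduced radial BVP (first target: the octahedral rung-4 cell, MODEL
root OCT-P93); COFINALITY needs a mechanism in `L`: θ-continuation `L → L+2` inside the O_h-poloidal class with a priori
bounds (⇔ a Liouville theorem for the steady cell-reduced Galerkin system — open), or a large-`L` asymptotic (sectoral /
thin-shell) ansatz fed into stub 1. Why it might fail: the rung-4 root may be a truncation artefact that disappears or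
degenerates (`K → ∞`, fold) along the ladder — the ℓ_max = 8 run shows a near-fold passage at θ ≈ 0.15–0.35 and a
drifting shell radius `13.7 → 19.4 → 26.3` — and for large `L` every steady `NS_L` profile may be trivial, as for NS
itself (Tsai 1998), by a mechanism not yet in print (KJ-17: none of the 14 printed criteria applies to `NS_L`). -/
theorem stub_nondegenerate_approx_profiles_cofinal :
    ∀ L₀ : ℕ, ∃ L ≥ L₀, ∃ (K C : ℝ), 0 < C ∧ ∀ η > 0,
      ∃ (U₀ : ℝ³ → ℝ³) (Q₀ : ℝ³ → ℝ) (E₀ : ℝ³ → ℝ³),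
        IsApproxLerayRungProfile L K C η U₀ Q₀ E₀ ∧ ∃ y, C / 2 ≤ (1 + ‖y‖) * ‖U₀ y‖ := by
  sorry

/-- BC5-TYPE FIRST RUNG (plan-only; T3-style witness of weakness for `C⁺`): **rung FOUR carries a non-trivial steady
Leray profile.** Technique: computer-assisted existence (radii polynomials / interval Newton–Kantorovich, i.e. stub 1's
door instantiated at `L = 4`) for the O_h-poloidal cell-reduced BVP `(T∞),(P∞)` of HOME/profile/z2oct/
OCT-REDUCED-SYSTEM.md §2 around the MODEL root OCT-P93 (`A = 22.33126`, `ρ_A = 13.686`, `Q(0) = −2.133e−3`,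
`ρ⁴Q → −53.4`; 4 codes, grid-converged) — a numerical root, NOT a proof. Outside S's known regime (nothing is proved
about singular behaviour of any `NS_L`, `L ≥ 1`; rung 0 is regular, p484389; rung 3's T-cell is linear, p503248) and it
exercises the route's lever at the first nonlinear symmetric rung. By O-invariance a rung-4 O-cell profile is also a
rung-5 profile (no O-invariant harmonic of degree 5), but symmetry gaps never give cofinality. An axisymmetric profile
would satisfy this letter too but is chain-dead for K3 (p466949): aim at the O cell. -/
theorem stub_leray_rung_four : RungHasLerayProfile 4 := by
  sorry

/-! ## Compositions (real proofs) -/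

/-- **Rung `L` has a steady Leray profile ⇒ rung `L` is singular** — REAL PROOF by the landed bridge
`AngularGalerkinLadderLerayLine.rungIsSingular_of_lerayProfile` (circuit g10, p517517): the lift
`u = lerayBackward ½ 0 U = (−t)^{−1/2}U(x/√−t)`, `p = lerayBackwardPressure ½ 0 Q`, `d = (−t)^{−3/2}E(x/√−t)` is an
ancient rung-`L` solution, DSS with factor `2` and trivial rotation, Type-I with constant `C`, non-zero at `t = −1`. -/
theorem rungIsSingular_of_rungHasLerayProfile {L : ℕ} (hL : RungHasLerayProfile L) :
    AngularLadder.RungIsSingular L := by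
  obtain ⟨C, U, Q, E, ⟨hband, hdiv, hQ, -, hcob, hres, hdec⟩, hnz⟩ := hL
  refine AngularGalerkinLadderLerayLine.rungIsSingular_of_lerayProfile hband.1 hQ (fun y => ?_) hdiv hband hcob
    hdec hnz
  exact sub_eq_zero.mp (hres y)

/-- **The stationary strengthening `C⁺` implies the crux** — hypothesis-free real theorem (the transfer of record):
`(∀ L₀, ∃ L ≥ L₀, RungHasLerayProfile L) → RungBlowupCofinal`. -/
theorem RungBlowupCofinal_of_lerayProfiles_cofinal (hcof : ∀ L₀ : ℕ, ∃ L ≥ L₀, RungHasLerayProfile L) : Goal := by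
  show Summit.NavierStokesRegularity.NavierStokesRegularity.Theses.AngularGalerkinLadder.RungBlowupCofinal
  intro L₀
  obtain ⟨L, hL, hP⟩ := hcof L₀
  exact ⟨L, hL, rungIsSingular_of_rungHasLerayProfile hP⟩

/-- **The door opens onto a non-trivial profile** (real proof from stubs 1 and 2 at one rung): an exact profile within
`C/4` of an approximate profile of weighted amplitude `≥ C/2 > 0` is not identically zero. -/
theorem rungHasLerayProfile_of_door {L : ℕ} {K C : ℝ} (hC : 0 < C)
    (hdoor : ∃ η > 0, ∀ (U₀ : ℝ³ → ℝ³) (Q₀ : ℝ³ → ℝ) (E₀ : ℝ³ → ℝ³),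
      IsApproxLerayRungProfile L K C η U₀ Q₀ E₀ →
        ∃ (C' : ℝ) (U : ℝ³ → ℝ³) (Q : ℝ³ → ℝ) (E : ℝ³ → ℝ³),
          IsSteadyLerayRungProfile L C' U Q E ∧ ∀ y, (1 + ‖y‖) * ‖U y - U₀ y‖ ≤ C / 4)
    (happrox : ∀ η > 0, ∃ (U₀ : ℝ³ → ℝ³) (Q₀ : ℝ³ → ℝ) (E₀ : ℝ³ → ℝ³),
      IsApproxLerayRungProfile L K C η U₀ Q₀ E₀ ∧ ∃ y, C / 2 ≤ (1 + ‖y‖) * ‖U₀ y‖) :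
    RungHasLerayProfile L := by
  obtain ⟨η, hη, hd⟩ := hdoor
  obtain ⟨U₀, Q₀, E₀, hA, y₀, hy₀⟩ := happrox η hη
  obtain ⟨C', U, Q, E, hP, hclose⟩ := hd U₀ Q₀ E₀ hA
  refine ⟨C', U, Q, E, hP, y₀, ?_⟩
  intro hU0
  have h1 : (1 + ‖y₀‖) * ‖U y₀ - U₀ y₀‖ ≤ C / 4 := hclose y₀
  rw [hU0, zero_sub, norm_neg] at h1
  linarith

/-- **The crux from the two open stubs** (real proof): pick a cofinal rung with non-degenerate approximate profiles,
pass the Newton–Kantorovich door to an exact non-trivial steady Leray rung profile, lift it (p517517). -/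
theorem RungBlowupCofinal_of
    (h1 : ∀ (L : ℕ) (K C : ℝ), ∃ η > 0, ∀ (U₀ : ℝ³ → ℝ³) (Q₀ : ℝ³ → ℝ) (E₀ : ℝ³ → ℝ³),
      IsApproxLerayRungProfile L K C η U₀ Q₀ E₀ →
        ∃ (C' : ℝ) (U : ℝ³ → ℝ³) (Q : ℝ³ → ℝ) (E : ℝ³ → ℝ³),
          IsSteadyLerayRungProfile L C' U Q E ∧ ∀ y, (1 + ‖y‖) * ‖U y - U₀ y‖ ≤ C / 4)
    (h2 : ∀ L₀ : ℕ, ∃ L ≥ L₀, ∃ (K C : ℝ), 0 < C ∧ ∀ η > 0,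
      ∃ (U₀ : ℝ³ → ℝ³) (Q₀ : ℝ³ → ℝ) (E₀ : ℝ³ → ℝ³),
        IsApproxLerayRungProfile L K C η U₀ Q₀ E₀ ∧ ∃ y, C / 2 ≤ (1 + ‖y‖) * ‖U₀ y‖) : Goal := by
  refine RungBlowupCofinal_of_lerayProfiles_cofinal fun L₀ => ?_
  obtain ⟨L, hL, K, C, hC, happrox⟩ := h2 L₀
  exact ⟨L, hL, rungHasLerayProfile_of_door hC (h1 L K C) happrox⟩

/-- **Which instances of the crux the BC5-type rung settles** (real proof from the rung-4 stub and p517517):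
`RungHasLerayProfile 4` yields `RungIsSingular 4`, hence every instance `L₀ ≤ 4` of K1. -/
theorem rungBlowupCofinal_instances_le_four (h4 : RungHasLerayProfile 4) :
    ∀ L₀ ≤ 4, ∃ L ≥ L₀, AngularLadder.RungIsSingular L := fun _ hL₀ =>
  ⟨4, hL₀, rungIsSingular_of_rungHasLerayProfile h4⟩

/-- The instances `L₀ ≤ 4`, consuming the rung stub (carries its `sorry`). -/
theorem rungBlowupCofinal_instances_le_four_skeleton : ∀ L₀ ≤ 4, ∃ L ≥ L₀, AngularLadder.RungIsSingular L :=
  rungBlowupCofinal_instances_le_four stub_leray_rung_four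

/-- The hypothesis-free skeleton line: carries the stubs' `sorry`s — decoration, not closure. -/
theorem RungBlowupCofinal_skeleton :
    Summit.NavierStokesRegularity.NavierStokesRegularity.Theses.AngularGalerkinLadder.RungBlowupCofinal :=
  RungBlowupCofinal_of stub_nk_door stub_nondegenerate_approx_profiles_cofinal

/-! ## Sanity (real proofs, no stubs): the letters are not inhabited by the recorded junk classes. -/

/-- The zero field is never a non-collapsing approximate profile: the amplitude floor `C/2 ≤ (1+‖y‖)‖U₀ y‖` with
`0 < C` fails for `U₀ = 0` (so the K2-v3 gauge junk `u ≡ 0, p = x₀, d = e₀` cannot inhabit stub 2). -/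
theorem not_floor_of_zero {C : ℝ} (hC : 0 < C) (y : ℝ³) :
    ¬ C / 2 ≤ (1 + ‖y‖) * ‖(0 : ℝ³ → ℝ³) y‖ := by
  simp only [Pi.zero_apply, norm_zero, mul_zero, not_le]
  linarith

/-- A steady Leray rung profile tends to `0` at spatial infinity — so no constant drift `e₀` (KJ-18) and no linear
strain field `A y` (KJ-20) is one. -/
theorem IsSteadyLerayRungProfile.tendsto_zero {L : ℕ} {C : ℝ} {U : ℝ³ → ℝ³} {Q : ℝ³ → ℝ} {E : ℝ³ → ℝ³}
    (h : IsSteadyLerayRungProfile L C U Q E) :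
    Tendsto (fun y : ℝ³ => ‖U y‖) (Filter.comap (fun y : ℝ³ => ‖y‖) atTop) (𝓝 0) := by
  have hdec := h.2.2.2.2.2.2
  have henv : Tendsto (fun y : ℝ³ => C / (‖y‖ + 1)) (Filter.comap (fun y : ℝ³ => ‖y‖) atTop) (𝓝 0) := by
    have h1 : Tendsto (fun r : ℝ => C / (r + 1)) atTop (𝓝 0) := by
      apply Tendsto.div_atTop tendsto_const_nhds
      exact tendsto_atTop_add_const_right _ _ tendsto_id
    exact h1.comp tendsto_comap
  refine squeeze_zero' (Eventually.of_forall fun y => norm_nonneg _) ?_ henv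
  exact Eventually.of_forall fun y => hdec y

end Summit.NavierStokesRegularity.NavierStokesRegularity.Cruxes.RungBlowupCofinal.Leray
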